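import Summits.ResolutionOfSingularities.ResolutionOfSingularities.Theorems.HilbertSamuelEliminationSigmaMaxModificationsCorridor3SigmaLocalChainsE
import Literature.AlgebraicGeometry.Resolution.EmbeddedResolution
import HarnessLib

/-!
# [OURS · L1 W4.2] `Corridor3WLadderHybridLowTree` — two strategy-free lemmas for the LOW ADAPTER: (i) a TREE LEMMA «finite levels,
# branching only at marked nodes, every thread eventually unmarked ⇒ only finitely many marked nodes», (ii) OFF THE CENTRE an irreducible
# closed set has at most ONE irreducible closed set dominating it along a blow-up; plus (SD2-comp) `finiteHits_of_componentCarrier`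

Crux chain w42 (`SigmaMaxModifications`, stmt-ResolutionOfSingularities-18506; conjunct `SigmaMaxModificationsCorridor3`,
stmt-ResolutionOfSingularities-19249), res-L1-w42-plan-1 RULINGS v3.14-21 (FS)/(FT)(SD2) and v3.14-22 (FW): the E7-Low adapter
`…Corridor3WLadderHybridLow` (res-type-040, this seat) replaces stub-4's LABEL argument for row (c) by a strategy-generic TREE argument on the
forest of stratum components through the chain points (edges = domination under the step projections; MARKED = contained in the centre). This
file holds its two strategy-free ingredients and the (SD2-comp) corollary of brick 4E. Typer res-type-040 (gen 19). OURS (cell res-hironaka, slot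
W4.2); NOT statements of H. Hironaka's manuscript [Hironaka2017] nor of [CossartJannsenSaito2020]; AI-drafted, weaker than expert review.
Sorry-free PROOF file: no definition, no named fact, no binder. Helper file `--supports stmt-ResolutionOfSingularities-19249` (counted 0).

Contents (namespace `…Theorems.SigmaMaxModificationsCorridor3.Sigma`):
* §1 `eventually_unmarked_of_threads` — FLAT encoding of an `ℕ`-levelled forest (`V`, `lvl : V → ℕ`, `par : V → V` one level down off level
  `0`, finite levels): if every UNMARKED node has at most one child and along every thread (`u : ℕ → V`, `lvl (u n) = n`, `par (u (n+1)) = u n`)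
  the marks stop, then the marks stop GLOBALLY (from some level on no node is marked). Proof: were there marked nodes at unbounded levels, the
  nodes with marked descendants at unbounded levels would form a non-empty finite inverse system (pigeonhole on each finite level), Kőnig
  (`Moving.exists_section_of_finite_nonempty`, p500484) gives a thread of such nodes, the thread is eventually unmarked, hence eventually
  non-branching, hence its late descendants ARE the thread — unmarked: contradiction.
* §2 `eq_of_closure_image_eq_of_not_subset_support` — along a blow-up `f : W' ⟶ W` in `C`, an irreducible closed `Z ⊄ V(C)` is dominated
  (`closure (f '' Z') = Z`) by AT MOST ONE irreducible closed `Z'` (generic point over generic point; `f` is an isomorphism over `W ∖ V(C)`,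
  Stacks 02OS = tree `IsBlowup.isIso_compl` + `existsUnique_preimage_of_isIso_morphismRestrict`). So the forest of §1 branches only at hits.
* §3 `finiteHits_of_componentCarrier` — (SD2-comp) of RULING (FT): along blow-up data on good stages a dominating lineage of
  positive-dimensional stratum COMPONENTS is contained in the centre only finitely often, for centres regular and inside `X(ν)` when they hit,
  `0 < N ≤ 3`, modulo the kill row (brick 4E's `movingLineageLocalizes_of_blowupData` + (K)). No strategy, no functionality, no marked point.

References: D. Kőnig 1927 / Mathlib `nonempty_sections_of_finite_inverse_system`; Stacks Tags 02OS, 0061 [StacksProject]; CJS LNM 2270 Lemma 6.30,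
p. 98 Step 9, p. 107 [CossartJannsenSaito2020]; tree `…WLadderStrataLineages` (p500484), `…SigmaLocalChains`/`…SigmaLocalChainsE` (p530900/p532417),
`Literature…EmbeddedResolution` (`existsUnique_preimage_of_isIso_morphismRestrict`).
-/

noncomputable section

set_option linter.dupNamespace false

open CategoryTheory CategoryTheory.Limits AlgebraicGeometry TopologicalSpace Topology IsLocalRing Order
open Summit.ResolutionOfSingularities.ResolutionOfSingularities.Theorems.CampaignW42
open Literature.AlgebraicGeometry.Resolution Literature.RingTheory.HilbertSamuel
open Literature.AlgebraicGeometry.CossartJannsenSaito2020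
open Summit.ResolutionOfSingularities.ResolutionOfSingularities.Theorems.SigmaMaxModificationsCorridor3
open Summit.ResolutionOfSingularities.ResolutionOfSingularities.Theorems.SigmaMaxModificationsCorridor3.Moving
open Scheme.IdealSheafData

namespace Summit.ResolutionOfSingularities.ResolutionOfSingularities.Theorems.SigmaMaxModificationsCorridor3.Sigma

universe u v

/-! ## §1. The tree lemma -/

/-- Ancestors: `j ≤ lvl v` levels down from `v` sits `par^[j] v`, at level `lvl v - j`. [folklore] -/
theorem lvl_iterate_par_add {V : Type v} (lvl : V → ℕ) (par : V → V) (hlvl : ∀ v, 0 < lvl v → lvl (par v) + 1 = lvl v) :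
    ∀ (j : ℕ) (v : V), j ≤ lvl v → lvl (par^[j] v) + j = lvl v := by
  intro j
  induction j with
  | zero => intro v _; simp
  | succ j ih =>
    intro v hj
    have h1 := ih v (Nat.le_of_succ_le hj)
    have h2 : 0 < lvl (par^[j] v) := by omega
    have h3 := hlvl _ h2
    rw [Function.iterate_succ_apply']
    omega

/-- **THE TREE LEMMA.** In an `ℕ`-levelled forest with finite levels (`lvl`, `par` one level down off level `0`), whose UNMARKED nodes have at
most one child, if along every thread the marks (`Mk`) stop, then the marks stop globally: from some level on no node is marked. [folklore] -/
theorem eventually_unmarked_of_threads {V : Type v} (lvl : V → ℕ) (par : V → V) (Mk : V → Prop)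
    (hfin : ∀ n, {v : V | lvl v = n}.Finite) (hlvl : ∀ v, 0 < lvl v → lvl (par v) + 1 = lvl v)
    (hbranch : ∀ v, ¬ Mk v → ∀ w₁ w₂, par w₁ = v → par w₂ = v → lvl w₁ = lvl v + 1 → lvl w₂ = lvl v + 1 → w₁ = w₂)
    (hthread : ∀ u : ℕ → V, (∀ n, lvl (u n) = n) → (∀ n, par (u (n + 1)) = u n) → ∃ n₀, ∀ n, n₀ ≤ n → ¬ Mk (u n)) :
    ∃ n₀, ∀ v, n₀ ≤ lvl v → ¬ Mk v := by
  have hanc := lvl_iterate_par_add lvl par hlvl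
  by_contra hinf
  push Not at hinf
  -- `hinf : ∀ n₀, ∃ v, n₀ ≤ lvl v ∧ Mk v`; `P v` := `v` has marked descendants at unbounded levels
  let P : V → Prop := fun v => ∀ J, ∃ b, Mk b ∧ J ≤ lvl b ∧ lvl v ≤ lvl b ∧ par^[lvl b - lvl v] b = v
  -- (A) every level carries a node with `P` (pigeonhole over the finite level)
  have hA : ∀ n, ∃ v, lvl v = n ∧ P v := by
    intro n
    by_contra hno
    have hno' : ∀ v, lvl v = n → ∃ J, ∀ b, Mk b → J ≤ lvl b → lvl v ≤ lvl b → par^[lvl b - lvl v] b ≠ v := by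
      intro v hv
      by_contra hall
      push Not at hall
      exact hno ⟨v, hv, hall⟩
    choose! J hJ using hno'
    obtain ⟨B, hB⟩ := ((hfin n).image J).bddAbove
    obtain ⟨b, hb, hMb⟩ := hinf (max B n)
    set a := par^[lvl b - n] b with ha
    have hla : lvl a = n := by
      have := hanc (lvl b - n) b (Nat.sub_le _ _)
      rw [← ha] at this
      omega
    have hJa : J a ≤ B := hB ⟨a, hla, rfl⟩
    refine hJ a hla b hMb (le_trans hJa (le_trans (le_max_left _ _) hb)) (by omega) ?_
    rw [hla]
  -- (B) Kőnig on the nodes with `P`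
  let F : ℕ → Type v := fun n => {v : V // lvl v = n ∧ P v}
  haveI : ∀ n, Finite (F n) := fun n => ((hfin n).subset fun v hv => hv.1).to_subtype
  haveI : ∀ n, Nonempty (F n) := fun n => by
    obtain ⟨v, hv, hP⟩ := hA n
    exact ⟨⟨v, hv, hP⟩⟩
  have hPpar : ∀ w, 0 < lvl w → P w → P (par w) := by
    intro w hw hP Jb
    obtain ⟨b, hMb, hJb, hwb, hdesc⟩ := hP Jb
    have hlw := hlvl w hw
    refine ⟨b, hMb, hJb, by omega, ?_⟩
    have : lvl b - lvl (par w) = (lvl b - lvl w) + 1 := by omega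
    rw [this, Function.iterate_succ_apply', hdesc]
  let d : ∀ n, F (n + 1) → F n := fun n w =>
    ⟨par w.1, by have := hlvl w.1 (by rw [w.2.1]; exact Nat.succ_pos n); rw [w.2.1] at this; omega,
      hPpar w.1 (by rw [w.2.1]; exact Nat.succ_pos n) w.2.2⟩
  obtain ⟨u, hu⟩ := exists_section_of_finite_nonempty (F := F) d
  let t : ℕ → V := fun n => (u n).1
  have htl : ∀ n, lvl (t n) = n := fun n => (u n).2.1
  have htp : ∀ n, par (t (n + 1)) = t n := fun n => congrArg Subtype.val (hu n)
  have htP : ∀ n, P (t n) := fun n => (u n).2.2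
  -- (C) the thread is eventually unmarked, hence eventually its own set of descendants
  obtain ⟨n₀, hn₀⟩ := hthread t htl htp
  have hC : ∀ (j : ℕ) (b : V), lvl b = n₀ + j → par^[j] b = t n₀ → b = t (n₀ + j) := by
    intro j
    induction j with
    | zero => intro b _ hb; simpa using hb
    | succ j ih =>
      intro b hl hb
      rw [Function.iterate_succ_apply] at hb
      have h2 : lvl (par b) = n₀ + j := by
        have := hlvl b (by omega)
        omega
      have h3 := ih (par b) h2 hb
      have hlt : lvl (t (n₀ + j + 1)) = lvl (t (n₀ + j)) + 1 := by rw [htl, htl]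
      exact hbranch (t (n₀ + j)) (hn₀ _ (Nat.le_add_right _ _)) b (t (n₀ + j + 1)) h3 (htp _) (by rw [htl]; omega) hlt
  obtain ⟨b, hMb, hJb, -, hdesc⟩ := htP n₀ n₀
  rw [htl] at hdesc
  have hb : b = t (n₀ + (lvl b - n₀)) := hC (lvl b - n₀) b (by omega) hdesc
  exact hn₀ (n₀ + (lvl b - n₀)) (Nat.le_add_right _ _) (hb ▸ hMb)

/-! ## §2. Off the centre an irreducible closed set has at most one dominating irreducible closed set -/

/-- **Along a blow-up `f : W' ⟶ W` in `C`, an irreducible closed `Z ⊄ V(C)` is dominated by at most one irreducible closed set**: if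
`closure (f '' Z₁) = Z = closure (f '' Z₂)` with `Z₁, Z₂` irreducible closed, then `Z₁ = Z₂` (their generic points lie over the generic point of
`Z`, which is off the centre, where `f` is injective). [cite: StacksProject, Tag 02OS] -/
theorem eq_of_closure_image_eq_of_not_subset_support {W W' : Scheme.{u}} {f : W' ⟶ W} {C : W.IdealSheafData} (hb : IsBlowup f C)
    {Z : Set W} (hZ : IsIrreducible Z) (hZcl : IsClosed Z) (hZC : ¬ Z ⊆ (C.support : Set W))
    {Z₁ Z₂ : Set W'} (h₁ : IsIrreducible Z₁) (h₁cl : IsClosed Z₁) (h₂ : IsIrreducible Z₂) (h₂cl : IsClosed Z₂)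
    (hd₁ : closure (f.base '' Z₁) = Z) (hd₂ : closure (f.base '' Z₂) = Z) : Z₁ = Z₂ := by
  have hη : IsGenericPoint hZ.genericPoint Z := by
    have h := hZ.isGenericPoint_genericPoint_closure
    rwa [hZcl.closure_eq] at h
  have hη₁ : IsGenericPoint h₁.genericPoint Z₁ := by
    have h := h₁.isGenericPoint_genericPoint_closure
    rwa [h₁cl.closure_eq] at h
  have hη₂ : IsGenericPoint h₂.genericPoint Z₂ := by
    have h := h₂.isGenericPoint_genericPoint_closure
    rwa [h₂cl.closure_eq] at h
  have e₁ : f.base h₁.genericPoint = hZ.genericPoint := base_eq_of_isGenericPoint_of_closure_image_eq f hd₁ hη₁ hη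
  have e₂ : f.base h₂.genericPoint = hZ.genericPoint := base_eq_of_isGenericPoint_of_closure_image_eq f hd₂ hη₂ hη
  have hηC : hZ.genericPoint ∉ (C.support : Set W) := fun h =>
    hZC ((hη.mem_closed_set_iff C.support.isClosed).mp h)
  obtain ⟨x, -, huniq⟩ := existsUnique_preimage_of_isIso_morphismRestrict f hb.isIso_compl
    (show hZ.genericPoint ∈ (⟨(C.support : Set W)ᶜ, C.support.isClosed.isOpen_compl⟩ : W.Opens) from hηC)
  have h12 : h₁.genericPoint = h₂.genericPoint := (huniq _ e₁).trans (huniq _ e₂).symm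
  rw [← hη₁.def, ← hη₂.def, h12]

/-! ## §3. (SD2-comp): a component carrier is hit finitely often -/

/-- **(SD2-comp) FINITE HITS OF A COMPONENT CARRIER — PROVED modulo the kill row.** Along blow-up data `f n : X_{n+1} ⟶ X_n`,
`IsBlowup (f n) (C n)` on GOOD stages of level `0 < N ≤ 3`, a dominating lineage of POSITIVE-DIMENSIONAL irreducible COMPONENTS `Z n` of the
strata `X_n(ν)` lies inside the centre only finitely often, provided the centre is regular and inside `X_n(ν)` whenever it contains `Z n`
(permissible in-stratum centres qualify). No strategy, no functionality, no marked point: the statement a NON-closed `ξ ∈ X_n(ν)` with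
closure a stratum component needs (plan-1 (FT)(SD2), component half). [cite: CossartJannsenSaito2020, Lemma 6.30, p. 98 Step 9, p. 107] -/
theorem finiteHits_of_componentCarrier {N : ℕ} {ν : ℕ → ℕ} {k : Type u} [Field k] {c : ℕ → MarkedStage.{u}}
    (hK : LocalNearPointChainsTerminate.{u}) (hN0 : 0 < N) (hN3 : N ≤ 3) (hgood : ∀ n, RunGood k N ν (c n).W)
    {f : ∀ n, (c (n + 1)).W ⟶ (c n).W} {C : ∀ n, (c n).W.IdealSheafData} (hb : ∀ n, IsBlowup (f n) (C n))
    {Z : ∀ n, Set (c n).W} (hZ : ∀ n, Z n ∈ componentsIn (Scheme.hsStratum (c n).W N ν))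
    (hZnt : ∀ n, (Z n).Nontrivial) (hdom : ∀ n, closure ((f n).base '' Z (n + 1)) = Z n)
    (hcen : ∀ n, Z n ⊆ ((C n).support : Set (c n).W) →
      Literature.AlgebraicGeometry.Resolution.Scheme.IsRegular (C n).subscheme ∧
        ((C n).support : Set (c n).W) ⊆ Scheme.hsStratum (c n).W N ν) :
    ∃ n₀, ∀ n, n₀ ≤ n → ¬ Z n ⊆ ((C n).support : Set (c n).W) := by
  by_contra h
  push Not at h
  obtain ⟨S, ln, pt, hexc, hred, hdim, hchain, hiso⟩ := movingLineageLocalizes_of_blowupData hgood hb hZ hZnt hdom hcen h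
  have h1 : ((N - 1 : ℕ) : WithBot ℕ∞) ≤ (2 : WithBot ℕ∞) := by
    have : N - 1 ≤ 2 := by omega
    exact_mod_cast this
  have h2 : ((N - 1 : ℕ) : WithBot ℕ∞) < (N : WithBot ℕ∞) := by
    have : N - 1 < N := by omega
    exact_mod_cast this
  exact hK N S ln pt hexc hred (hdim.trans h1) (lt_of_le_of_lt hdim h2) hchain hiso

end Summit.ResolutionOfSingularities.ResolutionOfSingularities.Theorems.SigmaMaxModificationsCorridor3.Sigma

end
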